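import Mathlib
import Summits.Ventures.PercRepro2.ThreeTermPinnedCube

/-!
# Three-terminal parts, V c: per-copy pinned counts and `K₃` along a graph embedding
(blind cell PercRepro2, night-3 g30, 2026-08-29; `proofs/NIGHT3-CERT.md` §39.7)

A core's partition table is computed on the PART GRAPH of an instance, whose edge type carries the
part's edges (pinned closed and looped) and whose vertex type carries the part's vertices (isolated).
To read a table evaluated on a small model (ThreeTermInstanceHOB.lean: `Fin 5` edges, `Fin 6` vertices)
on EVERY instance that contains the core, the count must be transported along an embedding of the
model into the instance: vertex map `ν`, edge map `ι`, both injective, edges to edges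
(`PartEmbed`, the shape of typer-1's `Inst8.Embed` with a general target and no `off` condition).

* `ext φ x` — the configuration of the big graph open exactly on the images of the open edges of `x`
  (`ext_ι`, `ext_off`, `ext_injective`, `exists_ext_of_closed`);
* **`conn_ext_iff`** — connectivity between image vertices is connectivity in the model (a closure
  argument each way; an open edge of an extension is an image edge, so it joins image vertices);
* **`K3_ext`** — the kernel `K₃` of the big graph at image marks and extensions is the kernel of the
  model (the twelve functions are indicators of connection events);
* **`typedCount3_ext`** — the per-copy pinned count of the big graph with extended pins, typed edges
  the image of the model's, is the model's per-copy pinned count: every contributing triple is closed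
  off the image, so it is an extension (`Finset.sum_subset` + `Finset.sum_image`).

Own work (the pattern of Inst8Embed.lean, generalised); standard axioms.
-/

namespace Summit.Ventures.PercRepro2

open TypedStar

namespace Part

/-! ## Embeddings of graphs -/

/-- An embedding of the graph `ends₀ : E₀ → Sym2 V₀` into `ends : E → Sym2 V`: injective vertex and
edge maps, edges to edges. -/
structure PartEmbed {V₀ E₀ V E : Type*} (ends₀ : E₀ → Sym2 V₀) (ends : E → Sym2 V) where
  /-- The vertex map. -/
  ν : V₀ → V
  /-- The edge map. -/
  ι : E₀ → E
  /-- The vertex map is injective. -/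
  ν_inj : Function.Injective ν
  /-- The edge map is injective. -/
  ι_inj : Function.Injective ι
  /-- Edges map to edges. -/
  ends_eq : ∀ e, ends (ι e) = (ends₀ e).map ν

section Ext

variable {V₀ E₀ V E : Type*} {ends₀ : E₀ → Sym2 V₀} {ends : E → Sym2 V} (φ : PartEmbed ends₀ ends)

/-- The extension of a configuration along the embedding: open exactly on the images of open edges. -/
noncomputable def ext (x : Config E₀) : Config E :=
  fun j => by classical exact decide (∃ e, φ.ι e = j ∧ x e = true)

/-- The extension on an image edge. -/
lemma ext_ι (x : Config E₀) (e : E₀) : ext φ x (φ.ι e) = x e := by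
  classical
  rw [Bool.eq_iff_iff]
  unfold ext
  rw [decide_eq_true_iff]
  constructor
  · rintro ⟨e', he', hx⟩
    rwa [φ.ι_inj he'] at hx
  · intro hx
    exact ⟨e, rfl, hx⟩

/-- The extension is closed off the image. -/
lemma ext_off (x : Config E₀) {j : E} (hj : ∀ e, φ.ι e ≠ j) : ext φ x j = false := by
  classical
  unfold ext
  rw [decide_eq_false_iff_not]
  rintro ⟨e, he, -⟩
  exact hj e he

/-- The extension is injective. -/
lemma ext_injective : Function.Injective (ext φ) := by
  intro x y h
  funext e
  rw [← ext_ι φ x e, ← ext_ι φ y e, h]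

/-- A configuration closed off the image is an extension. -/
lemma exists_ext_of_closed (x' : Config E) (h : ∀ j, (∀ e, φ.ι e ≠ j) → x' j = false) :
    ∃ x : Config E₀, ext φ x = x' := by
  classical
  refine ⟨fun e => x' (φ.ι e), ?_⟩
  funext j
  by_cases hj : ∃ e, φ.ι e = j
  · obtain ⟨e, rfl⟩ := hj
    rw [ext_ι]
  · rw [not_exists] at hj
    rw [ext_off φ _ hj, h j hj]

/-! ## Connectivity along the embedding -/

/-- Open adjacency between image vertices corresponds. -/
lemma openAdj_ext_iff (x : Config E₀) (u v : V₀) :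
    OpenAdj ends (ext φ x) (φ.ν u) (φ.ν v) ↔ OpenAdj ends₀ x u v := by
  classical
  constructor
  · rintro ⟨j, hj, hends⟩
    unfold ext at hj
    rw [decide_eq_true_iff] at hj
    obtain ⟨e, rfl, hx⟩ := hj
    refine ⟨e, hx, ?_⟩
    rw [φ.ends_eq] at hends
    exact Sym2.map.injective φ.ν_inj (hends.trans (Sym2.map_mk φ.ν u v).symm)
  · rintro ⟨e, he, h⟩
    exact ⟨φ.ι e, by rw [ext_ι]; exact he, by rw [φ.ends_eq, h, Sym2.map_mk]⟩

/-- An open neighbour of an image vertex is an image vertex. -/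
lemma openAdj_ext_range (x : Config E₀) (u : V₀) {y : V} (h : OpenAdj ends (ext φ x) (φ.ν u) y) :
    ∃ v, φ.ν v = y := by
  classical
  obtain ⟨j, hj, hends⟩ := h
  unfold ext at hj
  rw [decide_eq_true_iff] at hj
  obtain ⟨e, rfl, -⟩ := hj
  rw [φ.ends_eq] at hends
  have hy : y ∈ (ends₀ e).map φ.ν := by rw [hends]; exact Sym2.mem_mk_right _ _
  rw [Sym2.mem_map] at hy
  obtain ⟨v, -, hv⟩ := hy
  exact ⟨v, hv⟩

/-- **Connectivity along the embedding.** -/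
theorem conn_ext_iff (x : Config E₀) (u v : V₀) :
    Conn ends (ext φ x) (φ.ν u) (φ.ν v) ↔ Conn ends₀ x u v := by
  constructor
  · intro h
    have hS : ∀ y ∈ {y : V | ∃ w, φ.ν w = y ∧ Conn ends₀ x u w}, ∀ y',
        (openGraph ends (ext φ x)).Adj y y' → y' ∈ {y : V | ∃ w, φ.ν w = y ∧ Conn ends₀ x u w} := by
      rintro y ⟨w, rfl, hw⟩ y' hadj
      rw [openGraph_adj] at hadj
      obtain ⟨w', rfl⟩ := openAdj_ext_range φ x w hadj.2
      refine ⟨w', rfl, hw.trans ?_⟩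
      have hne : w ≠ w' := fun h => hadj.1 (by rw [h])
      exact (openGraph_adj.2 ⟨hne, (openAdj_ext_iff φ x w w').1 hadj.2⟩).reachable
    have := mem_of_conn_of_closed hS ⟨u, rfl, conn_refl ends₀ x u⟩ h
    obtain ⟨w, hw, hconn⟩ := this
    rwa [φ.ν_inj hw] at hconn
  · intro h
    have hS : ∀ w ∈ {w : V₀ | Conn ends (ext φ x) (φ.ν u) (φ.ν w)}, ∀ w',
        (openGraph ends₀ x).Adj w w' → w' ∈ {w : V₀ | Conn ends (ext φ x) (φ.ν u) (φ.ν w)} := by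
      intro w hw w' hadj
      rw [openGraph_adj] at hadj
      have hne : φ.ν w ≠ φ.ν w' := fun h => hadj.1 (φ.ν_inj h)
      exact hw.trans (openGraph_adj.2 ⟨hne, (openAdj_ext_iff φ x w w').2 hadj.2⟩).reachable
    exact mem_of_conn_of_closed hS (conn_refl ends (ext φ x) (φ.ν u)) h

/-! ## The kernel `K₃` along the embedding -/

variable {R : Type*} [Field R]

/-- Indicators of events related by an equivalence agree (two carrier types). -/
lemma indicator_one_eq_of_iff' {α β : Type*} {X : Set α} {Y : Set β} {a : α} {b : β}
    (h : a ∈ X ↔ b ∈ Y) : X.indicator (1 : α → R) a = Y.indicator (1 : β → R) b := by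
  by_cases ha : a ∈ X
  · rw [Set.indicator_of_mem ha, Set.indicator_of_mem (h.mp ha)]
    rfl
  · rw [Set.indicator_of_notMem ha, Set.indicator_of_notMem (fun h' => ha (h.mpr h'))]

/-- The indicator of a connection event, along the embedding. -/
lemma indicator_connEvent_ext (x : Config E₀) (u v : V₀) :
    (connEvent ends₀ u v).indicator (1 : Config E₀ → R) x =
      (connEvent ends (φ.ν u) (φ.ν v)).indicator (1 : Config E → R) (ext φ x) := by
  refine indicator_one_eq_of_iff' ?_
  rw [mem_connEvent, mem_connEvent, conn_ext_iff]

/-- The indicator of `Q = {a₁ ↮ a₂}`, along the embedding. -/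
lemma indicator_avoidAll_ext (x : Config E₀) (a₁ a₂ : V₀) :
    (avoidAll ends₀ a₂ {a₁}).indicator (1 : Config E₀ → R) x =
      (avoidAll ends (φ.ν a₂) {φ.ν a₁}).indicator (1 : Config E → R) (ext φ x) := by
  refine indicator_one_eq_of_iff' ?_
  simp only [mem_avoidAll, Finset.mem_singleton, forall_eq, conn_ext_iff]

/-- The indicator of `PD`, along the embedding. -/
lemma indicator_PDEvent_ext (x : Config E₀) (a₁ a₂ a₃ : V₀) :
    (PDEvent ends₀ a₁ a₂ a₃).indicator (1 : Config E₀ → R) x =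
      (PDEvent ends (φ.ν a₁) (φ.ν a₂) (φ.ν a₃)).indicator (1 : Config E → R) (ext φ x) := by
  refine indicator_one_eq_of_iff' ?_
  simp only [PDEvent, Dtilde, UnionCluster.inU, Set.mem_inter_iff, Set.mem_compl_iff, Set.mem_union,
    mem_connEvent, conn_ext_iff]

/-- **The kernel `K₃` of the model is the kernel of the big graph along the embedding.** -/
theorem K3_ext (o a₁ a₂ a₃ b : V₀) (x y w : Config E₀) :
    CovForm.K3 (R := R) ends₀ o a₁ a₂ a₃ b x y w =
      CovForm.K3 (R := R) ends (φ.ν o) (φ.ν a₁) (φ.ν a₂) (φ.ν a₃) (φ.ν b)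
        (ext φ x) (ext φ y) (ext φ w) := by
  unfold CovForm.K3 CovForm.sepKernel CovForm.f3 CovForm.f4 CovForm.f5 CovForm.f6 CovForm.f7
    CovForm.f10 CovForm.f11 CovForm.f12 CovForm.sigma CovForm.inU CovForm.iQ CovForm.iPD CovForm.iL
    CovForm.iH
  simp only [Fin.sum_univ_succ, Fin.sum_univ_zero, Matrix.cons_val_zero, Matrix.cons_val_succ,
    add_zero, indicator_connEvent_ext φ, indicator_avoidAll_ext φ, indicator_PDEvent_ext φ]

end Ext

/-! ## Per-copy pinned counts along the embedding -/

section Count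

variable {V₀ E₀ V E : Type*} [Fintype E₀] [DecidableEq E₀] [Fintype E] [DecidableEq E]
  {ends₀ : E₀ → Sym2 V₀} {ends : E → Sym2 V} (φ : PartEmbed ends₀ ends) {R : Type*} [CommRing R]

omit [Fintype E₀] [DecidableEq E₀] [Fintype E] [DecidableEq E] in
/-- Open counts along the embedding. -/
lemma openCount_ext (x y w : Config E₀) (e : E₀) :
    openCount (ext φ x) (ext φ y) (ext φ w) (φ.ι e) = openCount x y w e := by
  unfold openCount
  rw [ext_ι, ext_ι, ext_ι]

omit [DecidableEq E₀] [Fintype E] in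
/-- The pinned-triple condition along the embedding. -/
lemma cond_ext_iff (F₀ : Finset E₀) (x₀ y₀ w₀ : Config E₀) {τ : E → ℕ} {τ₀ : E₀ → ℕ}
    (hτ : ∀ e ∈ F₀, τ (φ.ι e) = τ₀ e) (x y w : Config E₀) :
    ((∀ j, j ∉ F₀.map ⟨φ.ι, φ.ι_inj⟩ → ext φ x j = ext φ x₀ j ∧ ext φ y j = ext φ y₀ j ∧
        ext φ w j = ext φ w₀ j) ∧ (∀ j ∈ F₀.map ⟨φ.ι, φ.ι_inj⟩, openCount (ext φ x) (ext φ y) (ext φ w) j = τ j)) ↔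
      ((∀ e, e ∉ F₀ → x e = x₀ e ∧ y e = y₀ e ∧ w e = w₀ e) ∧ (∀ e ∈ F₀, openCount x y w e = τ₀ e)) := by
  constructor
  · rintro ⟨hoff, hF⟩
    refine ⟨fun e he => ?_, fun e he => ?_⟩
    · have hj : φ.ι e ∉ F₀.map ⟨φ.ι, φ.ι_inj⟩ := by
        rw [Finset.mem_map]
        rintro ⟨e', he', h⟩
        simp only [Function.Embedding.coeFn_mk] at h
        exact he (φ.ι_inj h ▸ he')
      have := hoff _ hj
      simpa only [ext_ι] using this
    · have := hF (φ.ι e) (Finset.mem_map_of_mem _ he)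
      rwa [openCount_ext, hτ e he] at this
  · rintro ⟨hoff, hF⟩
    refine ⟨fun j hj => ?_, fun j hj => ?_⟩
    · by_cases he : ∃ e, φ.ι e = j
      · obtain ⟨e, rfl⟩ := he
        have heF : e ∉ F₀ := fun h => hj (Finset.mem_map_of_mem _ h)
        simp only [ext_ι]
        exact hoff e heF
      · rw [not_exists] at he
        simp only [ext_off φ _ he, and_self]
    · rw [Finset.mem_map] at hj
      obtain ⟨e, heF, rfl⟩ := hj
      simp only [Function.Embedding.coeFn_mk]
      rw [openCount_ext, hτ e heF]
      exact hF e heF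

/-- The extension of a triple. -/
noncomputable def ext3 (t : Config E₀ × Config E₀ × Config E₀) : Config E × Config E × Config E :=
  (ext φ t.1, ext φ t.2.1, ext φ t.2.2)

omit [Fintype E₀] [DecidableEq E₀] [Fintype E] [DecidableEq E] in
/-- The extension of triples is injective. -/
lemma ext3_injective : Function.Injective (ext3 φ) := by
  rintro ⟨x, y, w⟩ ⟨x', y', w'⟩ h
  simp only [ext3, Prod.mk.injEq] at h
  obtain ⟨h1, h2, h3⟩ := h
  rw [ext_injective φ h1, ext_injective φ h2, ext_injective φ h3]

/-- **The per-copy pinned count along the embedding**: with the typed edges the image of the model's and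
the pins extended, the count of the big graph is the model's count of the pulled-back kernel. -/
theorem typedCount3_ext (F₀ : Finset E₀) (x₀ y₀ w₀ : Config E₀) {τ : E → ℕ} {τ₀ : E₀ → ℕ}
    (hτ : ∀ e ∈ F₀, τ (φ.ι e) = τ₀ e) (K : Config E → Config E → Config E → R) :
    typedCount3 (F₀.map ⟨φ.ι, φ.ι_inj⟩) (ext φ x₀) (ext φ y₀) (ext φ w₀) τ K =
      typedCount3 F₀ x₀ y₀ w₀ τ₀ (fun x y w => K (ext φ x) (ext φ y) (ext φ w)) := by
  unfold typedCount3
  rw [flatten3', flatten3']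
  -- the big sum is supported on the image of `ext3`
  have hsupp : ∀ t : Config E × Config E × Config E, t ∉ Finset.univ.image (ext3 φ) →
      (if (∀ j, j ∉ F₀.map ⟨φ.ι, φ.ι_inj⟩ → t.1 j = ext φ x₀ j ∧ t.2.1 j = ext φ y₀ j ∧
            t.2.2 j = ext φ w₀ j) ∧ (∀ j ∈ F₀.map ⟨φ.ι, φ.ι_inj⟩, openCount t.1 t.2.1 t.2.2 j = τ j)
        then K t.1 t.2.1 t.2.2 else 0) = 0 := by
    intro t ht
    rw [if_neg]
    rintro ⟨hoff, -⟩
    apply ht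
    rw [Finset.mem_image]
    have hcl : ∀ (c : Config E) (c₀ : Config E₀), (∀ j, j ∉ F₀.map ⟨φ.ι, φ.ι_inj⟩ → c j = ext φ c₀ j) →
        ∀ j, (∀ e, φ.ι e ≠ j) → c j = false := by
      intro c c₀ hc j hj
      have hjF : j ∉ F₀.map ⟨φ.ι, φ.ι_inj⟩ := by
        rw [Finset.mem_map]
        rintro ⟨e, -, he⟩
        exact hj e he
      rw [hc j hjF, ext_off φ c₀ hj]
    obtain ⟨x, hx⟩ := exists_ext_of_closed φ t.1 (hcl t.1 x₀ fun j hj => (hoff j hj).1)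
    obtain ⟨y, hy⟩ := exists_ext_of_closed φ t.2.1 (hcl t.2.1 y₀ fun j hj => (hoff j hj).2.1)
    obtain ⟨w, hw⟩ := exists_ext_of_closed φ t.2.2 (hcl t.2.2 w₀ fun j hj => (hoff j hj).2.2)
    exact ⟨(x, y, w), Finset.mem_univ _, by simp only [ext3, hx, hy, hw]⟩
  rw [← Finset.sum_subset (Finset.subset_univ _) (fun t _ ht => hsupp t ht),
    Finset.sum_image (fun a _ b _ h => ext3_injective φ h)]
  refine Finset.sum_congr rfl fun t _ => ?_
  simp only [ext3]
  rw [if_congr (cond_ext_iff φ F₀ x₀ y₀ w₀ hτ t.1 t.2.1 t.2.2) rfl rfl]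

end Count

end Part

end Summit.Ventures.PercRepro2
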